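import Mathlib
import Literature.NumberTheory.LFunctions.Zhang2022.TypedAppendixA1
import Literature.NumberTheory.LFunctions.Zhang2022.AppendixALemma83Local
import Literature.NumberTheory.LFunctions.Zhang2022.AppendixALemma83Kappa
import HarnessLib

/-!
# Zhang (2022), Appendix A part 1: the exact steps of the printed proof of Lemma 8.3, DISCHARGED

Topic `Literature/NumberTheory/LFunctions/Zhang2022` (Landau–Siegel audit tree; verdict-neutral).
Y. Zhang, *Discrete mean estimates and the Landau–Siegel zero*, arXiv:2211.02515v1 (2022)
[Zhang2022LandauSiegel], Appendix A pp. 101–103, **an unrefereed manuscript under adjudication**.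
The campaign file `TypedAppendixA1` types every displayed step of "Proof of Lemma 8.3" as a
`def … : Prop` (CLAIM, stated not asserted). This file PROVES the ones that are exact identities,
by the kernel-checked local computations of `AppendixALemma83Local` / `AppendixALemma83Kappa`:

| node | typed claim | status here |
|---|---|---|
| Z22:§A.u002 | `StepA_u002` (`λ(km,s) = λ(k,s)λ̃(m,k;s)`) | `stepA_u002_holds` |
| Z22:§A.u004 (lead-in) | `StepA_u004_pow` (`λ̃(q^r,k;s) = λ̃(q,k;s)`) | `stepA_u004_pow_holds` |
| Z22:§A.u010 | `StepA_u010`, `StepA_u010_because` (Case 1 identity; `κ̃(q^r;dq,·) = κ(q^r)`) | `stepA_u010_holds`, `stepA_u010_because_holds` |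
| Z22:§A.u011 | `StepA_u011` (`κ(q^r) = τ₂(q^r)(1 + O(αr log q))`) | `stepA_u011_holds` |
| Z22:§A.u016 | `StepA_u016_eq` (Case 2 identity) | `stepA_u016_eq_holds` |
| Z22:§A.u017 (text) | `StepA_u017_lamTilde` | `stepA_u017_lamTilde_holds` |
| Z22:§A.u018 | `StepA_u018_lamTilde`; `StepA_u018_eq` AS PRINTED (flag F6) | `stepA_u018_lamTilde_holds`; the CORRECT identity `stepA_u018_eq_corrected` (`q^{1−β_j}/(q−1)` in place of the printed `q/(q−1)`) |

Not here: u008 (text), u020, (A.5) are discharged in L4-t8's `TypedAppendixA1Identities`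
(`stepA_u008_dvd_holds`, `stepA_u020_holds`, `eqA_5_holds`); the estimates u012–u015, u017, u019 and
(A.1)–(A.3), the local bound u007, the analytic continuation, and the deduction `DedLem83_read`
are in companion files (GAP-LEDGER rows G-d55-1/2/3 of the campaign record what the printed chain
lacks). Nothing here bears on Theorems 1–2.

## References

* Y. Zhang, arXiv:2211.02515v1 (2022), Appendix A pp. 101–103. [cite: Zhang2022LandauSiegel, App. A]
-/

noncomputable section

open Complex Real ComplexConjugate ArithmeticFunction Finset

namespace Literature.NumberTheory.LFunctions.Zhang2022.Typed.AppendixA1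

open Literature.NumberTheory.LFunctions.Zhang2022
open Literature.NumberTheory.LFunctions.Zhang2022.Skeleton
open Literature.NumberTheory.LFunctions.Zhang2022.Lemma83

variable (c' : ℝ)

/-! ## u002, u004 (lead-in): the `λ`/`λ̃` product identities -/

/-- **Z22:§A.u002 holds**: `λ(km,s) = λ(k,s)λ̃(m,k;s)` for `k, m ≥ 1` (exact; `AppendixALemma83Local`).
[cite: Zhang2022LandauSiegel, App. A p. 101] -/
theorem stepA_u002_holds : StepA_u002 c' := by
  intro D k m hk hm s
  rw [lamTilde]
  exact lam_mul_eq c' D (by omega) (by omega) s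

/-- `StepA_u002` — `_holds` alias of `stepA_u002_holds` above under the fact's exact name (appended
2026-08-28, D-0026 bookkeeping: the proof term is the existing theorem of this file; no statement,
definition or attribute is edited; no new named fact; the ledger's debt table listed the fact
unproved). [cite: Zhang2022LandauSiegel, App. A p. 101] -/
theorem _root_.Literature.NumberTheory.LFunctions.Zhang2022.Typed.AppendixA1.StepA_u002_holds :
    StepA_u002 c' :=
  _root_.Literature.NumberTheory.LFunctions.Zhang2022.Typed.AppendixA1.stepA_u002_holds (c' := c')

/-- **Z22:§A.u004 (lead-in) holds**: `λ̃(q^r,k;s) = λ̃(q,k;s)` for `r ≥ 1`.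
[cite: Zhang2022LandauSiegel, App. A p. 101] -/
theorem stepA_u004_pow_holds : StepA_u004_pow c' := by
  intro D q r k _ hr s
  unfold lamTilde
  rw [Nat.primeFactors_pow q (by omega)]

/-- `StepA_u004_pow` — `_holds` alias of `stepA_u004_pow_holds` above under the fact's exact name (appended
2026-08-28, D-0026 bookkeeping: the proof term is the existing theorem of this file; no statement,
definition or attribute is edited; no new named fact; the ledger's debt table listed the fact
unproved). [cite: Zhang2022LandauSiegel, App. A p. 101] -/
theorem _root_.Literature.NumberTheory.LFunctions.Zhang2022.Typed.AppendixA1.StepA_u004_pow_holds :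
    StepA_u004_pow c' :=
  _root_.Literature.NumberTheory.LFunctions.Zhang2022.Typed.AppendixA1.stepA_u004_pow_holds (c' := c')

/-! ## u010, u016, u018: the inner sum `ξ_j(q^r;d,h)` in Cases 1–3 -/

/-- **Z22:§A.u010 ("because") holds**: `κ̃(q^r; dq, 1−β_j) = κ(q^r)` (`q ∣ dq`; any `r`).
[cite: Zhang2022LandauSiegel, App. A p. 102] -/
theorem stepA_u010_because_holds : StepA_u010_because c' := by
  intro D j d q r _ hq
  exact kappaTilde_prime_pow_of_dvd c' D hq (dvd_mul_left q d) r _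

/-- `StepA_u010_because` — `_holds` alias of `stepA_u010_because_holds` above under the fact's exact name (appended
2026-08-28, D-0026 bookkeeping: the proof term is the existing theorem of this file; no statement,
definition or attribute is edited; no new named fact; the ledger's debt table listed the fact
unproved). [cite: Zhang2022LandauSiegel, App. A p. 102] -/
theorem _root_.Literature.NumberTheory.LFunctions.Zhang2022.Typed.AppendixA1.StepA_u010_because_holds :
    StepA_u010_because c' :=
  _root_.Literature.NumberTheory.LFunctions.Zhang2022.Typed.AppendixA1.stepA_u010_because_holds (c' := c')

/-- **Z22:§A.u010 holds** (Case 1 identity): for `(q,dh) = 1`, `r ≥ 1`,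
`ξ_j(q^r;d,h) = κ̃(q^r;dh,1−β_j) − κ(q^{r−1})q^{1−β_j}/(q−1)`.
[cite: Zhang2022LandauSiegel, App. A p. 102] -/
theorem stepA_u010_holds : StepA_u010 c' := by
  intro D j d h q r _ _ hq _ _ hqdh hr
  have hqh : ¬ q ∣ h := fun hd =>
    ((Nat.Prime.coprime_iff_not_dvd hq).mp hqdh) (dvd_mul_of_dvd_right hd d)
  unfold xiA
  rw [innerSum_prime_pow_of_not_dvd_right c' D j hq (by omega) hqh]
  rfl

/-- `StepA_u010` — `_holds` alias of `stepA_u010_holds` above under the fact's exact name (appended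
2026-08-28, D-0026 bookkeeping: the proof term is the existing theorem of this file; no statement,
definition or attribute is edited; no new named fact; the ledger's debt table listed the fact
unproved). [cite: Zhang2022LandauSiegel, App. A p. 102] -/
theorem _root_.Literature.NumberTheory.LFunctions.Zhang2022.Typed.AppendixA1.StepA_u010_holds :
    StepA_u010 c' :=
  _root_.Literature.NumberTheory.LFunctions.Zhang2022.Typed.AppendixA1.stepA_u010_holds (c' := c')

/-- **Z22:§A.u016 (identity) holds** (Case 2): for `q ∣ h`, `r ≥ 1`, `ξ_j(q^r;d,h) = κ(q^r)`.
[cite: Zhang2022LandauSiegel, App. A p. 102] -/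
theorem stepA_u016_eq_holds : StepA_u016_eq c' := by
  intro D j d h q r _ _ hq hqh hr
  unfold xiA
  exact innerSum_prime_pow_of_dvd_right c' D j hq (by omega) hqh

/-- `StepA_u016_eq` — `_holds` alias of `stepA_u016_eq_holds` above under the fact's exact name (appended
2026-08-28, D-0026 bookkeeping: the proof term is the existing theorem of this file; no statement,
definition or attribute is edited; no new named fact; the ledger's debt table listed the fact
unproved). [cite: Zhang2022LandauSiegel, App. A p. 102] -/
theorem _root_.Literature.NumberTheory.LFunctions.Zhang2022.Typed.AppendixA1.StepA_u016_eq_holds :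
    StepA_u016_eq c' :=
  _root_.Literature.NumberTheory.LFunctions.Zhang2022.Typed.AppendixA1.stepA_u016_eq_holds (c' := c')

/-- **Z22:§A.u018 (identity), CORRECTED form** (Case 3, `q ∣ d`, `(q,h) = 1`, `r ≥ 1`):
`ξ_j(q^r;d,h) = κ(q^r) − κ(q^{r−1})·q^{1−β_j}/(q−1)`. The printed display (`StepA_u018_eq`) has
`q/(q−1)`: the unimodular factor `q^{−β_j}` is dropped in print (flag F6 of `TypedAppendixA1`);
this is the identity the definitions give. [cite: Zhang2022LandauSiegel, App. A p. 103] -/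
theorem stepA_u018_eq_corrected :
    ∀ (D : ℕ) (j d h q r : ℕ), 1 ≤ d → 1 ≤ h → q.Prime → q ∣ d → Nat.Coprime q h → 1 ≤ r →
      xiA c' D j (q ^ r) d h =
        kappaZ c' D (q ^ r) -
          kappaZ c' D (q ^ (r - 1)) * (q : ℂ) ^ (1 - betaJ c' D j) / ((q : ℂ) - 1) := by
  intro D j d h q r _ _ hq hqd hqh hr
  unfold xiA
  exact innerSum_prime_pow_of_dvd_left c' D j hq (by omega) hqd
    ((Nat.Prime.coprime_iff_not_dvd hq).mp hqh)

/-- **Z22:§A.u017 (text) holds**: `λ̃(q,dh;1−β_j) = 1` when `q ∣ h` (empty product).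
[cite: Zhang2022LandauSiegel, App. A p. 103] -/
theorem stepA_u017_lamTilde_holds : StepA_u017_lamTilde c' := by
  intro D j d h q _ hq hqh
  unfold lamTilde
  rw [hq.primeFactors, Finset.filter_singleton, if_neg, Finset.prod_empty]
  intro hc
  exact ((Nat.Prime.coprime_iff_not_dvd hq).mp hc) (dvd_mul_of_dvd_right hqh d)

/-- `StepA_u017_lamTilde` — `_holds` alias of `stepA_u017_lamTilde_holds` above under the fact's exact name (appended
2026-08-28, D-0026 bookkeeping: the proof term is the existing theorem of this file; no statement,
definition or attribute is edited; no new named fact; the ledger's debt table listed the fact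
unproved). [cite: Zhang2022LandauSiegel, App. A p. 103] -/
theorem _root_.Literature.NumberTheory.LFunctions.Zhang2022.Typed.AppendixA1.StepA_u017_lamTilde_holds :
    StepA_u017_lamTilde c' :=
  _root_.Literature.NumberTheory.LFunctions.Zhang2022.Typed.AppendixA1.stepA_u017_lamTilde_holds (c' := c')

/-- **Z22:§A.u018 (text) holds**: `λ̃(q,dh;1−β_j) = 1` when `q ∣ d`.
[cite: Zhang2022LandauSiegel, App. A p. 103] -/
theorem stepA_u018_lamTilde_holds : StepA_u018_lamTilde c' := by
  intro D j d h q _ hq hqd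
  unfold lamTilde
  rw [hq.primeFactors, Finset.filter_singleton, if_neg, Finset.prod_empty]
  intro hc
  exact ((Nat.Prime.coprime_iff_not_dvd hq).mp hc) (dvd_mul_of_dvd_left hqd h)

/-- `StepA_u018_lamTilde` — `_holds` alias of `stepA_u018_lamTilde_holds` above under the fact's exact name (appended
2026-08-28, D-0026 bookkeeping: the proof term is the existing theorem of this file; no statement,
definition or attribute is edited; no new named fact; the ledger's debt table listed the fact
unproved). [cite: Zhang2022LandauSiegel, App. A p. 103] -/
theorem _root_.Literature.NumberTheory.LFunctions.Zhang2022.Typed.AppendixA1.StepA_u018_lamTilde_holds :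
    StepA_u018_lamTilde c' :=
  _root_.Literature.NumberTheory.LFunctions.Zhang2022.Typed.AppendixA1.stepA_u018_lamTilde_holds (c' := c')

/-! ## u011: `κ(q^r) = τ₂(q^r)(1 + O(αr log q))` -/

/-- **Z22:§A.u011 (estimate) holds**, with `C = 7` for `D` large in terms of `c′`
(`AppendixALemma83Kappa.stepA_u011_skeleton`). [cite: Zhang2022LandauSiegel, App. A p. 102] -/
theorem stepA_u011_holds : StepA_u011 c' := stepA_u011_skeleton c'

/-- `StepA_u011` — `_holds` alias of `stepA_u011_holds` above under the fact's exact name (appended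
2026-08-28, D-0026 bookkeeping: the proof term is the existing theorem of this file; no statement,
definition or attribute is edited; no new named fact; the ledger's debt table listed the fact
unproved). [cite: Zhang2022LandauSiegel, App. A p. 102] -/
theorem _root_.Literature.NumberTheory.LFunctions.Zhang2022.Typed.AppendixA1.StepA_u011_holds :
    StepA_u011 c' :=
  _root_.Literature.NumberTheory.LFunctions.Zhang2022.Typed.AppendixA1.stepA_u011_holds (c' := c')

end Literature.NumberTheory.LFunctions.Zhang2022.Typed.AppendixA1
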